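import Mathlib
import Literature.Analysis.ODE.DampedLatticePicard
import Literature.Analysis.ODE.GlobalExistence
import HarnessLib

/-!
# Continuation and global existence for damped lattice systems `ẋ_j = f_j(x) − c_j x_j`

Trunk: analysis / ODE.  Companion of `DampedLatticePicard` (local existence with a window independent
of the damping rates).  Here: the **continuation principle in a-priori-bound form** (Teschl 2012,
Cor. 2.16: a solution that stays in a bounded set extends) for the componentwise formulation — a
damped flow on `[0, b]` all of whose continuations obey an a priori sup bound `R` on `[0, T]` extends
to `[0, T]` (uniform steps of the damping-free Picard window, glued componentwise with
`ODE.solution_append`) — and **global existence on `[0, ∞)`** from a priori bounds on every finite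
horizon (nested continuations), with continuously differentiable components.  Used for the NS-scaled
viscous cascade lattices of Tao 2016 §4.

## References
* G. Teschl, *Ordinary Differential Equations and Dynamical Systems*, GSM 140 (AMS 2012), Thm. 2.2,
  Cor. 2.15–2.16, Thm. 2.17. [Teschl2012]
-/

noncomputable section

open Set Metric Filter Topology BoundedContinuousFunction

open scoped NNReal

namespace Literature.Analysis.ODE

variable {ι : Type*} [TopologicalSpace ι] [DiscreteTopology ι]

/-- **Continuation under an a priori bound (damped lattice systems).**  Let `f` be componentwise
`K`-Lipschitz and `L`-bounded on the ball `‖U‖ ≤ R + 1` and continuous along componentwise-continuous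
curves there, `c_j ≥ 0` arbitrary damping rates, `J` a frozen index set.  A damped flow `𝓤` on
`[0, b]` from `x₀` (`0 ≤ b ≤ T`) such that every damped flow on `[0, s]`, `b ≤ s ≤ T`, agreeing with
`𝓤` on `[0, b]` obeys `‖·‖ ≤ R` on `[0, s]`, extends to a damped flow on `[0, T]` (steps of the fixed
length `1/(K+L+1)` of `exists_dampedFlow_short`, glued componentwise).
[cite: Teschl2012, Cor. 2.16 (with Thm. 2.2)] -/
theorem dampedFlow_extend (f : (ι →ᵇ ℝ) → (ι →ᵇ ℝ)) (c : ι → ℝ) (hc : ∀ j, 0 ≤ c j)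
    (J : Set ι) (hJ : ∀ U : ι →ᵇ ℝ, (∀ j ∈ J, U j = 0) → ∀ j ∈ J, f U j = 0)
    {R K L : ℝ} (hK : 0 ≤ K) (hL : 0 ≤ L)
    (hlip : ∀ U V : ι →ᵇ ℝ, ‖U‖ ≤ R + 1 → ‖V‖ ≤ R + 1 → ∀ j, |f U j - f V j| ≤ K * ‖U - V‖)
    (hbdd : ∀ U : ι →ᵇ ℝ, ‖U‖ ≤ R + 1 → ∀ j, |f U j| ≤ L)
    (hcont : ∀ 𝓥 : ℝ → (ι →ᵇ ℝ), (∀ t, ‖𝓥 t‖ ≤ R + 1) → (∀ j, Continuous fun t => 𝓥 t j) →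
      ∀ j, Continuous fun t => f (𝓥 t) j)
    (x₀ : ι →ᵇ ℝ) {b T : ℝ} (hb : 0 ≤ b) (hbT : b ≤ T)
    (𝓤 : ℝ → (ι →ᵇ ℝ)) (h0 : 𝓤 0 = x₀) (hbound : ∀ t, ‖𝓤 t‖ ≤ R + 1)
    (hfrozen : ∀ t, ∀ j ∈ J, 𝓤 t j = 0) (hcts : ∀ j, Continuous fun t => 𝓤 t j)
    (hsol : ∀ j, ∀ t ∈ Icc 0 b,
      HasDerivWithinAt (fun s => 𝓤 s j) (f (𝓤 t) j - c j * 𝓤 t j) (Icc 0 b) t)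
    (hapriori : ∀ s ∈ Icc b T, ∀ 𝓥 : ℝ → (ι →ᵇ ℝ), 𝓥 0 = x₀ → (∀ t, ‖𝓥 t‖ ≤ R + 1) →
      (∀ t, ∀ j ∈ J, 𝓥 t j = 0) → (∀ j, Continuous fun t => 𝓥 t j) →
      (∀ j, ∀ t ∈ Icc 0 s,
        HasDerivWithinAt (fun τ => 𝓥 τ j) (f (𝓥 t) j - c j * 𝓥 t j) (Icc 0 s) t) →
      (∀ t ∈ Icc 0 b, 𝓥 t = 𝓤 t) → ∀ t ∈ Icc 0 s, ‖𝓥 t‖ ≤ R) :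
    ∃ 𝓥 : ℝ → (ι →ᵇ ℝ), 𝓥 0 = x₀ ∧ (∀ t, ‖𝓥 t‖ ≤ R + 1) ∧ (∀ t, ∀ j ∈ J, 𝓥 t j = 0) ∧
      (∀ j, Continuous fun t => 𝓥 t j) ∧
      (∀ j, ∀ t ∈ Icc 0 T,
        HasDerivWithinAt (fun s => 𝓥 s j) (f (𝓥 t) j - c j * 𝓥 t j) (Icc 0 T) t) ∧
      ∀ t ∈ Icc 0 b, 𝓥 t = 𝓤 t := by
  -- the uniform step
  set δ : ℝ := 1 / (K + L + 1) with hδ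
  have hKL : 0 < K + L + 1 := by positivity
  have hδ0 : 0 < δ := by rw [hδ]; positivity
  have hKδ : K * δ < 1 := by
    rw [hδ, mul_one_div, div_lt_one hKL]; linarith
  have hδL : δ * L ≤ 1 := by
    rw [hδ, one_div, inv_mul_le_iff₀ hKL]; linarith
  -- n steps
  have step : ∀ n : ℕ, ∃ 𝓥 : ℝ → (ι →ᵇ ℝ), 𝓥 0 = x₀ ∧ (∀ t, ‖𝓥 t‖ ≤ R + 1) ∧
      (∀ t, ∀ j ∈ J, 𝓥 t j = 0) ∧ (∀ j, Continuous fun t => 𝓥 t j) ∧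
      (∀ j, ∀ t ∈ Icc 0 (min (b + n * δ) T), HasDerivWithinAt (fun s => 𝓥 s j)
        (f (𝓥 t) j - c j * 𝓥 t j) (Icc 0 (min (b + n * δ) T)) t) ∧
      ∀ t ∈ Icc 0 b, 𝓥 t = 𝓤 t := by
    intro n
    induction n with
    | zero =>
      refine ⟨𝓤, h0, hbound, hfrozen, hcts, ?_, fun t _ => rfl⟩
      have : min (b + ((0 : ℕ) : ℝ) * δ) T = b := by simp [min_eq_left hbT]
      rw [this]
      exact hsol
    | succ n ih =>
      obtain ⟨𝓥, h𝓥0, h𝓥b, h𝓥J, h𝓥c, h𝓥d, h𝓥𝓤⟩ := ih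
      set s : ℝ := min (b + n * δ) T with hs
      set s' : ℝ := min (b + ((n + 1 : ℕ) : ℝ) * δ) T with hs'
      have hbs : b ≤ s := le_min (by nlinarith [hδ0.le]) hbT
      have hsT : s ≤ T := min_le_right _ _
      have hss' : s ≤ s' := by
        refine min_le_min ?_ le_rfl
        push_cast; nlinarith [hδ0.le]
      have hs's : s' ≤ s + δ := by
        rw [hs', hs]
        rcases le_total (b + n * δ) T with h | h
        · rw [min_eq_left h]; refine (min_le_left _ _).trans ?_; push_cast; linarith
        · rw [min_eq_right h]; exact (min_le_right _ _).trans (by linarith)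
      have hs0 : 0 ≤ s := hb.trans hbs
      -- the state at time `s` obeys the a priori bound
      have hx₁ : ‖𝓥 s‖ ≤ R :=
        hapriori s ⟨hbs, hsT⟩ 𝓥 h𝓥0 h𝓥b h𝓥J h𝓥c h𝓥d h𝓥𝓤 s ⟨hs0, le_rfl⟩
      -- short flow from the state at time `s`
      obtain ⟨𝓦, h𝓦0, h𝓦b, h𝓦J, h𝓦c, h𝓦d⟩ := exists_dampedFlow_short f c hc J hJ hK hL hδ0
        hlip hbdd hcont (𝓥 s) (by linarith) hKδ (h𝓥J s)
      -- glue
      set 𝓥' : ℝ → (ι →ᵇ ℝ) := fun t => if t ≤ s then 𝓥 t else 𝓦 (t - s) with h𝓥'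
      have hle : ∀ t, t ≤ s → 𝓥' t = 𝓥 t := fun t ht => by simp [h𝓥', ht]
      have hge : ∀ t, s ≤ t → 𝓥' t = 𝓦 (t - s) := fun t ht => by
        rcases eq_or_lt_of_le ht with rfl | hlt
        · simp [h𝓥', h𝓦0]
        · simp [h𝓥', not_le.2 hlt]
      refine ⟨𝓥', by rw [hle 0 hs0, h𝓥0], fun t => ?_, fun t j hj => ?_, fun j => ?_, fun j t ht => ?_,
        fun t ht => by rw [hle t (ht.2.trans hbs), h𝓥𝓤 t ht]⟩
      · by_cases ht : t ≤ s
        · rw [hle t ht]; exact h𝓥b t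
        · rw [hge t (le_of_not_ge ht)]; exact h𝓦b _
      · by_cases ht : t ≤ s
        · rw [hle t ht]; exact h𝓥J t j hj
        · rw [hge t (le_of_not_ge ht)]; exact h𝓦J _ j hj
      · have h1 : Continuous fun t => 𝓦 (t - s) j := (h𝓦c j).comp (continuous_id.sub continuous_const)
        have h2 := (h𝓥c j).if_le h1 continuous_id continuous_const (fun t ht => by
          simp only [id] at ht
          rw [ht, sub_self, h𝓦0])
        have hfun : (fun σ => 𝓥' σ j) = fun σ => if σ ≤ s then 𝓥 σ j else 𝓦 (σ - s) j := by
          funext σ; by_cases hσ : σ ≤ s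
          · rw [hle σ hσ, if_pos hσ]
          · rw [hge σ (le_of_not_ge hσ), if_neg hσ]
        rw [hfun]; exact h2
      · -- componentwise gluing of the two solutions
        have hα : ∀ τ ∈ Icc 0 s, HasDerivWithinAt (fun σ => 𝓥 σ j)
            ((fun (τ : ℝ) (_ : ℝ) => f (𝓥' τ) j - c j * 𝓥' τ j) τ (𝓥 τ j)) (Icc 0 s) τ := by
          intro τ hτ
          simp only [hle τ hτ.2]
          exact h𝓥d j τ hτ
        have hβ : ∀ τ ∈ Icc s s', HasDerivWithinAt (fun σ => 𝓦 (σ - s) j)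
            ((fun (τ : ℝ) (_ : ℝ) => f (𝓥' τ) j - c j * 𝓥' τ j) τ (𝓦 (τ - s) j)) (Icc s s') τ := by
          intro τ hτ
          simp only [hge τ hτ.1]
          have hmem : τ - s ∈ Icc 0 δ := ⟨by linarith [hτ.1], by linarith [hτ.2]⟩
          have h1 := h𝓦d j (τ - s) hmem
          have h2 : HasDerivWithinAt (fun σ : ℝ => σ - s) 1 (Icc s s') τ :=
            (hasDerivWithinAt_id τ _).sub_const s
          have hmaps : MapsTo (fun σ : ℝ => σ - s) (Icc s s') (Icc 0 δ) := fun σ hσ =>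
            ⟨by linarith [hσ.1], by linarith [hσ.2, hs's]⟩
          have h3 := h1.comp τ h2 hmaps
          simpa [Function.comp_def] using h3
        have happ := solution_append (v := fun (τ : ℝ) (_ : ℝ) => f (𝓥' τ) j - c j * 𝓥' τ j)
          (α := fun σ => 𝓥 σ j) (β := fun σ => 𝓦 (σ - s) j) hα hβ hs0 hss'
          (by show 𝓥 s j = 𝓦 (s - s) j; rw [sub_self, h𝓦0]) t ht
        have hfun : (fun σ => 𝓥' σ j) = fun σ => if σ ≤ s then 𝓥 σ j else 𝓦 (σ - s) j := by
          funext σ; by_cases hσ : σ ≤ s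
          · rw [hle σ hσ, if_pos hσ]
          · rw [hge σ (le_of_not_ge hσ), if_neg hσ]
        rw [hfun]
        have hval : (if t ≤ s then 𝓥 t j else 𝓦 (t - s) j) = 𝓥' t j := by
          by_cases hσ : t ≤ s
          · rw [hle t hσ, if_pos hσ]
          · rw [hge t (le_of_not_ge hσ), if_neg hσ]
        simpa only [hval] using happ
  -- enough steps to reach `T`
  obtain ⟨n, hn⟩ : ∃ n : ℕ, T ≤ b + n * δ := by
    obtain ⟨n, hn⟩ := exists_nat_ge ((T - b) / δ)
    refine ⟨n, ?_⟩
    rw [div_le_iff₀ hδ0] at hn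
    linarith
  obtain ⟨𝓥, h1, h2, h3, h4, h5, h6⟩ := step n
  rw [min_eq_right hn] at h5
  exact ⟨𝓥, h1, h2, h3, h4, h5, h6⟩

/-- **Global existence on `[0, ∞)` from a priori bounds (damped lattice systems).**  If `f` is
componentwise Lipschitz and bounded on every ball and continuous along componentwise-continuous bounded
curves, `c_j ≥ 0`, `J` frozen by `f`, `x₀|_J = 0`, and for every horizon `T > 0` some `R ≥ ‖x₀‖`
bounds `‖𝓥 t‖` on `[0, s]` for every bounded damped flow `𝓥` from `x₀` on `[0, s] ⊆ [0, T]`, then there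
is a GLOBAL damped flow from `x₀`: `𝓤 0 = x₀`, frozen on `J`, bounded on every `[0, T]`, with
`d/dt 𝓤_j = f(𝓤)_j − c_j 𝓤_j` within `[0, ∞)` and this derivative continuous on `[0, ∞)` for every
`j` (nested continuations on `[0, m]`, `m ∈ ℕ`). [cite: Teschl2012, Cor. 2.16 and Thm. 2.17] -/
theorem exists_dampedFlow_Ici (f : (ι →ᵇ ℝ) → (ι →ᵇ ℝ)) (c : ι → ℝ) (hc : ∀ j, 0 ≤ c j)
    (J : Set ι) (hJ : ∀ U : ι →ᵇ ℝ, (∀ j ∈ J, U j = 0) → ∀ j ∈ J, f U j = 0)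
    (hlip : ∀ R : ℝ, 0 ≤ R → ∃ K : ℝ, 0 ≤ K ∧
      ∀ U V : ι →ᵇ ℝ, ‖U‖ ≤ R → ‖V‖ ≤ R → ∀ j, |f U j - f V j| ≤ K * ‖U - V‖)
    (hbdd : ∀ R : ℝ, 0 ≤ R → ∃ L : ℝ, 0 ≤ L ∧ ∀ U : ι →ᵇ ℝ, ‖U‖ ≤ R → ∀ j, |f U j| ≤ L)
    (hcont : ∀ (R : ℝ) (𝓥 : ℝ → (ι →ᵇ ℝ)), (∀ t, ‖𝓥 t‖ ≤ R) → (∀ j, Continuous fun t => 𝓥 t j) →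
      ∀ j, Continuous fun t => f (𝓥 t) j)
    (x₀ : ι →ᵇ ℝ) (hx₀J : ∀ j ∈ J, x₀ j = 0)
    (hapriori : ∀ T : ℝ, 0 < T → ∃ R : ℝ, ‖x₀‖ ≤ R ∧ ∀ s ∈ Ioc 0 T, ∀ 𝓥 : ℝ → (ι →ᵇ ℝ),
      𝓥 0 = x₀ → (∃ M : ℝ, ∀ t, ‖𝓥 t‖ ≤ M) → (∀ t, ∀ j ∈ J, 𝓥 t j = 0) →
      (∀ j, Continuous fun t => 𝓥 t j) →
      (∀ j, ∀ t ∈ Icc 0 s,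
        HasDerivWithinAt (fun τ => 𝓥 τ j) (f (𝓥 t) j - c j * 𝓥 t j) (Icc 0 s) t) →
      ∀ t ∈ Icc 0 s, ‖𝓥 t‖ ≤ R) :
    ∃ 𝓤 : ℝ → (ι →ᵇ ℝ), 𝓤 0 = x₀ ∧ (∀ t, ∀ j ∈ J, 𝓤 t j = 0) ∧
      (∀ T : ℝ, 0 < T → ∃ M : ℝ, ∀ t ∈ Icc 0 T, ‖𝓤 t‖ ≤ M) ∧
      (∀ j, ContinuousOn (fun t => f (𝓤 t) j - c j * 𝓤 t j) (Ici 0)) ∧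
      ∀ j, ∀ t ∈ Ici 0,
        HasDerivWithinAt (fun s => 𝓤 s j) (f (𝓤 t) j - c j * 𝓤 t j) (Ici 0) t := by
  -- the property of the `m`-th nested flow
  let P : ℕ → (ℝ → (ι →ᵇ ℝ)) → Prop := fun m 𝓥 => 𝓥 0 = x₀ ∧ (∃ M : ℝ, ∀ t, ‖𝓥 t‖ ≤ M) ∧
    (∀ t, ∀ j ∈ J, 𝓥 t j = 0) ∧ (∀ j, Continuous fun t => 𝓥 t j) ∧
    ∀ j, ∀ t ∈ Icc 0 (m : ℝ),
      HasDerivWithinAt (fun τ => 𝓥 τ j) (f (𝓥 t) j - c j * 𝓥 t j) (Icc 0 (m : ℝ)) t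
  -- one continuation step `[0, m] → [0, m + 1]`
  have step : ∀ (m : ℕ) (𝓥 : ℝ → (ι →ᵇ ℝ)), P m 𝓥 →
      ∃ 𝓥' : ℝ → (ι →ᵇ ℝ), P (m + 1) 𝓥' ∧ ∀ t ∈ Icc 0 (m : ℝ), 𝓥' t = 𝓥 t := by
    rintro m 𝓥 ⟨h𝓥0, ⟨M, hM⟩, h𝓥J, h𝓥c, h𝓥d⟩
    have hm : (0 : ℝ) ≤ m := Nat.cast_nonneg m
    have hm1 : (m : ℝ) ≤ ((m + 1 : ℕ) : ℝ) := by exact_mod_cast Nat.le_succ m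
    have hT : (0 : ℝ) < ((m + 1 : ℕ) : ℝ) := by exact_mod_cast Nat.succ_pos m
    obtain ⟨R, hx₀R, hR⟩ := hapriori ((m + 1 : ℕ) : ℝ) hT
    have hR0 : 0 ≤ R := (norm_nonneg _).trans hx₀R
    obtain ⟨K, hK, hKlip⟩ := hlip (R + 1) (by linarith)
    obtain ⟨L, hL, hLbdd⟩ := hbdd (R + 1) (by linarith)
    -- the a priori bound on `[0, m]` for `𝓥` itself
    have h𝓥R : ∀ t ∈ Icc 0 (m : ℝ), ‖𝓥 t‖ ≤ R := by
      intro t ht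
      rcases eq_or_lt_of_le ht.1 with h | h
      · rw [← h, h𝓥0]; exact hx₀R
      · have hmpos : (0 : ℝ) < m := h.trans_le ht.2
        exact hR m ⟨hmpos, hm1⟩ 𝓥 h𝓥0 ⟨M, hM⟩ h𝓥J h𝓥c h𝓥d t ht
    -- clamp `𝓥` to `[0, m]` so that it is globally bounded by `R`
    set κ : ℝ → ℝ := fun t => max 0 (min (m : ℝ) t) with hκ
    have hκc : Continuous κ := continuous_const.max (continuous_const.min continuous_id)
    have hκmem : ∀ t, κ t ∈ Icc 0 (m : ℝ) := fun t =>
      ⟨le_max_left _ _, max_le hm (min_le_left _ _)⟩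
    have hκid : ∀ t ∈ Icc 0 (m : ℝ), κ t = t := fun t ht => by
      rw [hκ]; simp only; rw [min_eq_right ht.2, max_eq_right ht.1]
    set 𝓥c : ℝ → (ι →ᵇ ℝ) := fun t => 𝓥 (κ t) with h𝓥c'
    have hceq : ∀ t ∈ Icc 0 (m : ℝ), 𝓥c t = 𝓥 t := fun t ht => by
      show 𝓥 (κ t) = 𝓥 t; rw [hκid t ht]
    have hc0 : 𝓥c 0 = x₀ := by rw [hceq 0 ⟨le_rfl, hm⟩, h𝓥0]
    have hcb : ∀ t, ‖𝓥c t‖ ≤ R + 1 := fun t => (h𝓥R (κ t) (hκmem t)).trans (by linarith)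
    have hcJ : ∀ t, ∀ j ∈ J, 𝓥c t j = 0 := fun t j hj => h𝓥J (κ t) j hj
    have hcc : ∀ j, Continuous fun t => 𝓥c t j := fun j => (h𝓥c j).comp hκc
    have hcd : ∀ j, ∀ t ∈ Icc 0 (m : ℝ), HasDerivWithinAt (fun τ => 𝓥c τ j)
        (f (𝓥c t) j - c j * 𝓥c t j) (Icc 0 (m : ℝ)) t := by
      intro j t ht
      rw [hceq t ht]
      exact (h𝓥d j t ht).congr (fun τ hτ => by show 𝓥 (κ τ) j = 𝓥 τ j; rw [hκid τ hτ])
        (by show 𝓥 (κ t) j = 𝓥 t j; rw [hκid t ht])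
    obtain ⟨𝓥', h1, h2, h3, h4, h5, h6⟩ := dampedFlow_extend f c hc J hJ hK hL hKlip hLbdd
      (hcont (R + 1)) x₀ hm hm1 𝓥c hc0 hcb hcJ hcc hcd
      (fun s hs 𝓦 h𝓦0 h𝓦b h𝓦J h𝓦c h𝓦d _ t ht => by
        rcases eq_or_lt_of_le ht.1 with h | h
        · rw [← h, h𝓦0]; exact hx₀R
        · exact hR s ⟨h.trans_le ht.2, hs.2⟩ 𝓦 h𝓦0 ⟨R + 1, h𝓦b⟩ h𝓦J h𝓦c h𝓦d t ht)
    exact ⟨𝓥', ⟨h1, ⟨R + 1, h2⟩, h3, h4, h5⟩, fun t ht => by rw [h6 t ht, hceq t ht]⟩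
  choose! ext hext using step
  -- the constant curve solves on `[0, 0]`
  let sol : ℕ → ℝ → (ι →ᵇ ℝ) := fun m => Nat.rec (fun _ => x₀) (fun m 𝓥 => ext m 𝓥) m
  have hsol : ∀ m : ℕ, P m (sol m) := by
    intro m
    induction m with
    | zero =>
      refine ⟨rfl, ⟨‖x₀‖, fun _ => le_rfl⟩, fun _ j hj => hx₀J j hj,
        fun j => (continuous_const : Continuous fun _ : ℝ => x₀ j), ?_⟩
      intro j t ht
      have ht0 : t = 0 := le_antisymm (by simpa using ht.2) ht.1
      subst ht0
      exact HasFDerivWithinAt.of_subsingleton (s := Icc (0 : ℝ) ((0 : ℕ) : ℝ))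
        (by rw [Nat.cast_zero]; exact subsingleton_Icc_of_ge le_rfl)
    | succ m ih => exact (hext m (sol m) ih).1
  have hnest : ∀ m : ℕ, ∀ t ∈ Icc 0 (m : ℝ), sol (m + 1) t = sol m t := fun m =>
    (hext m (sol m) (hsol m)).2
  have hnest' : ∀ m n : ℕ, m ≤ n → ∀ t ∈ Icc 0 (m : ℝ), sol n t = sol m t := by
    intro m n hmn
    induction n, hmn using Nat.le_induction with
    | base => exact fun _ _ => rfl
    | succ n hmn ih =>
      intro t ht
      have hmn' : (m : ℝ) ≤ n := by exact_mod_cast hmn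
      rw [hnest n t ⟨ht.1, ht.2.trans hmn'⟩, ih t ht]
  -- the global flow
  set 𝓤 : ℝ → (ι →ᵇ ℝ) := fun t => sol (⌈t⌉₊ + 1) t with h𝓤
  -- local agreement with a fixed nested flow
  have hagree : ∀ N : ℕ, ∀ t ∈ Icc 0 (N : ℝ), 𝓤 t = sol (N + 1) t := by
    intro N t ht
    have hle : ⌈t⌉₊ + 1 ≤ N + 1 := Nat.succ_le_succ (Nat.ceil_le.2 ht.2)
    have htm : t ∈ Icc 0 ((⌈t⌉₊ + 1 : ℕ) : ℝ) :=
      ⟨ht.1, (Nat.le_ceil t).trans (by exact_mod_cast Nat.le_succ _)⟩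
    exact (hnest' (⌈t⌉₊ + 1) (N + 1) hle t htm).symm
  have hderiv : ∀ j, ∀ t ∈ Ici (0 : ℝ),
      HasDerivWithinAt (fun s => 𝓤 s j) (f (𝓤 t) j - c j * 𝓤 t j) (Ici 0) t := by
    intro j t ht
    set N : ℕ := ⌈t⌉₊ + 1 with hN
    have htN : t < N := by
      rw [hN]; push_cast; linarith [Nat.le_ceil t]
    have hPN := hsol (N + 1)
    have hNN : (N : ℝ) ≤ ((N + 1 : ℕ) : ℝ) := by exact_mod_cast Nat.le_succ N
    have h1 : HasDerivWithinAt (fun s => sol (N + 1) s j) (f (sol (N + 1) t) j - c j * sol (N + 1) t j)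
        (Icc 0 (N : ℝ)) t :=
      (hPN.2.2.2.2 j t ⟨ht, htN.le.trans hNN⟩).mono (Icc_subset_Icc_right hNN)
    have h2 : HasDerivWithinAt (fun s => 𝓤 s j) (f (sol (N + 1) t) j - c j * sol (N + 1) t j)
        (Icc 0 (N : ℝ)) t :=
      h1.congr (fun s hs => by rw [hagree N s hs]) (by rw [hagree N t ⟨ht, htN.le⟩])
    rw [hagree N t ⟨ht, htN.le⟩]
    refine h2.mono_of_mem_nhdsWithin ?_
    exact mem_of_superset (inter_mem_nhdsWithin (Ici (0 : ℝ)) (Iio_mem_nhds htN))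
      fun s hs => ⟨hs.1, le_of_lt hs.2⟩
  refine ⟨𝓤, ?_, fun t j hj => ?_, fun T hT => ?_, fun j => ?_, hderiv⟩
  · exact (hsol (⌈(0 : ℝ)⌉₊ + 1)).1
  · exact (hsol (⌈t⌉₊ + 1)).2.2.1 t j hj
  · obtain ⟨M, hM⟩ := (hsol (⌈T⌉₊ + 1)).2.1
    refine ⟨M, fun t ht => ?_⟩
    rw [hagree ⌈T⌉₊ t ⟨ht.1, ht.2.trans (Nat.le_ceil T)⟩]
    exact hM t
  · -- continuity of the derivative on `[0, ∞)`: locally it is that of a bounded nested flow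
    intro t ht
    set N : ℕ := ⌈t⌉₊ + 1 with hN
    have htN : t < N := by
      rw [hN]; push_cast; linarith [Nat.le_ceil t]
    obtain ⟨h0', ⟨M, hM⟩, -, hc', -⟩ := hsol (N + 1)
    have hF : Continuous fun s => f (sol (N + 1) s) j - c j * sol (N + 1) s j :=
      (hcont M (sol (N + 1)) hM hc' j).sub (continuous_const.mul (hc' j))
    refine (hF.continuousWithinAt).congr_of_eventuallyEq ?_ (by rw [hagree N t ⟨ht, htN.le⟩])
    have hmem : Icc 0 (N : ℝ) ∈ 𝓝[Ici 0] t :=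
      mem_of_superset (inter_mem_nhdsWithin (Ici (0 : ℝ)) (Iio_mem_nhds htN))
        fun s hs => ⟨hs.1, le_of_lt hs.2⟩
    exact Filter.mem_of_superset hmem fun s hs => by
      show f (𝓤 s) j - c j * 𝓤 s j = f (sol (N + 1) s) j - c j * sol (N + 1) s j
      rw [hagree N s hs]

end Literature.Analysis.ODE

end
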